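import Summits.CriticalPhenomena.CardyFormulaZ2.Theorems.CardyAnchoredRigiditySubseqCardyJointLimitRotation
import Summits.CriticalPhenomena.CardyFormulaZ2.Theorems.CardyAnchoredRigiditySubseqCardyStubCountableApprox
import Summits.CriticalPhenomena.CardyFormulaZ2.Theorems.CardyAnchoredRigiditySubseqCardyStubDiagonalCauchy

/-!
# Cluster points of the crossing-function path are exactly the joint sequential limits
# (crux `SubseqCardy`, stmt-CriticalPhenomena-5768, line `registered`: structure of joint limits, part 4)

Route `CardyAnchoredRigidity` (decl shared with `CardyLocalRigidity`), sub-problem `CardyFormulaZ2`.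
The frame of both routes (items `SubseqCardy` 5768, `ClusterSetConnected` 5769, `CardyShadowIsolated`
5767) is phrased through the CLUSTER SET
`Λ' = {g | MapClusterPt g (𝓝[>] 0) (fun δ R ↦ bondDomainCrossingProb R δ)}` of the crossing-function
path in the product space `ConformalRectangle → ℝ`, whereas the stubs S2/S3 of this line and the
structure theory of parts 1–3 are phrased through JOINT SEQUENTIAL LIMITS (`u → 0⁺`,
`bondDomainCrossingProb R (u n) → g R` for every `R`). The product space is compact but not first
countable, so a priori a cluster point need not be a sequential limit. For THIS path it is:

* `JointLimit.exists_tendsto_of_mapClusterPt` — every cluster point `g ∈ Λ'` is a joint sequential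
  limit along some mesh sequence `u → 0⁺`. The path is "essentially separable": by countable uniform
  approximability (`stub_countableApprox`, S1b) a mesh sequence chosen to make the countably many
  coordinates `Rk k` converge to `g (Rk k)` (possible at a cluster point: finitely many coordinates at
  a time, meshes `< 1/(n+1)`) makes EVERY coordinate converge (Cauchy `ε/3`,
  `exists_tendsto_comp_of_forall_approx`), and the limit is `g R` because both `g R - g (Rk k)`
  (a cluster value of an eventually `ε`-small path) and `lim - g (Rk k)` are `ε`-small.
* `JointLimit.mapClusterPt_of_tendsto` — the converse (trivial), and the registered sub-goal
  `clusterPt_iff_jointLimit` : `g ∈ Λ' ↔ g` is a joint sequential limit.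
* Consequently every structure theorem of parts 2–3 holds for every `g ∈ Λ'`:
  `ClusterPt.map_addLeft` (translations), `ClusterPt.map_mul_I`, `ClusterPt.map_conj` (`D₄`),
  `ClusterPt.map_rotateQuad` (rotations, conditional on `dkkmo_crossing_rotation_invariance`),
  `ClusterPt.abs_sub_map_le` (Schramm–Smirnov continuity), `ClusterPt.map_dilate_mem` (`Λ'` is
  dilation invariant) — the form consumed by `CardyShadowIsolated` (stmt-5767).

References: O. Schramm, S. Smirnov, Ann. Probab. 39 (2011) §1.3, §5; J. K. Hale, *Asymptotic Behavior
of Dissipative Systems* (1988/2010) §3.1 (ω-limit sets).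
-/

noncomputable section

namespace Summit.CriticalPhenomena.CardyFormulaZ2.Cruxes.SubseqCardy.Birth

open Set Filter Topology Metric
open Literature.Probability.RandomPlanarGeometry (ConformalRectangle MarkedDomain)
open Literature.Probability.LatticeModels
open Literature.Probability.Percolation (bondDomainCrossingProb rotateQuad dkkmo_crossing_rotation_invariance)

namespace JointLimit

/-! ### Cluster points are joint sequential limits -/

/-- **Every cluster point of the crossing-function path is a joint sequential limit.** If `g` is a
cluster point, as `δ → 0⁺`, of `δ ↦ (R ↦ bondDomainCrossingProb R δ)` in the product space, then along
some sequence of meshes `u n → 0⁺` the crossing probabilities of EVERY conformal rectangle converge to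
`g`. [folklore] -/
theorem exists_tendsto_of_mapClusterPt {g : ConformalRectangle → ℝ}
    (hg : MapClusterPt g (𝓝[>] (0:ℝ)) (fun (δ : ℝ) (R : ConformalRectangle) => bondDomainCrossingProb R δ)) :
    ∃ u : ℕ → ℝ, Tendsto u atTop (𝓝[>] (0:ℝ)) ∧
      ∀ R : ConformalRectangle, Tendsto (fun n => bondDomainCrossingProb R (u n)) atTop (𝓝 (g R)) := by
  obtain ⟨Rk, hRk⟩ := stub_countableApprox
  -- (1) meshes `u n < 1/(n+1)` at which the first `n+1` coordinates are `1/(n+1)`-close to `g`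
  have hnbhd : ∀ n : ℕ, ∀ᶠ h in 𝓝 g, ∀ k ∈ Finset.range (n + 1), |h (Rk k) - g (Rk k)| < 1 / ((n:ℝ) + 1) := by
    intro n
    rw [Filter.eventually_all_finset]
    intro k _
    have hpos : (0:ℝ) < 1 / ((n:ℝ) + 1) := by positivity
    exact ((continuous_apply (Rk k)).continuousAt (x := g)).tendsto.eventually
      (eventually_abs_sub_lt (g (Rk k)) hpos)
  have hex : ∀ n : ℕ, ∃ δ : ℝ, (∀ k ∈ Finset.range (n + 1),
      |bondDomainCrossingProb (Rk k) δ - g (Rk k)| < 1 / ((n:ℝ) + 1)) ∧ δ ∈ Ioo (0:ℝ) (1 / ((n:ℝ) + 1)) := by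
    intro n
    have hpos : (0:ℝ) < 1 / ((n:ℝ) + 1) := by positivity
    exact ((hg.frequently (hnbhd n)).and_eventually (Ioo_mem_nhdsGT hpos)).exists
  choose u hu₁ hu₂ using hex
  -- (2) `u n → 0⁺`
  have hu : Tendsto u atTop (𝓝[>] (0:ℝ)) := by
    refine tendsto_nhdsWithin_iff.2 ⟨?_, Eventually.of_forall fun n => (hu₂ n).1⟩
    exact squeeze_zero (fun n => (hu₂ n).1.le) (fun n => (hu₂ n).2.le)
      (tendsto_one_div_add_atTop_nhds_zero_nat (𝕜 := ℝ))
  -- (3) the countably many coordinates converge to `g`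
  have hk : ∀ k : ℕ, Tendsto (fun n => bondDomainCrossingProb (Rk k) (u n)) atTop (𝓝 (g (Rk k))) := by
    intro k
    rw [Metric.tendsto_nhds]
    intro ε hε
    obtain ⟨N, hN⟩ := exists_nat_one_div_lt hε
    filter_upwards [eventually_ge_atTop (max k N)] with n hn
    have hkn : k ∈ Finset.range (n + 1) := Finset.mem_range.2 (by omega)
    have h1 := hu₁ n k hkn
    have hNn : (N:ℝ) ≤ n := by exact_mod_cast (le_max_right k N).trans hn
    have h2 : 1 / ((n:ℝ) + 1) ≤ 1 / ((N:ℝ) + 1) :=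
      one_div_le_one_div_of_le (by positivity) (by linarith)
    rw [Real.dist_eq]
    linarith
  -- (4) every coordinate converges, to `g R`
  refine ⟨u, hu, fun R => ?_⟩
  obtain ⟨x, hx⟩ := exists_tendsto_comp_of_forall_approx hu (a := fun δ => bondDomainCrossingProb R δ)
    (b := fun k δ => bondDomainCrossingProb (Rk k) δ) (hRk R) (fun k => ⟨_, hk k⟩)
  have hxg : x = g R := by
    refine eq_of_forall_dist_le fun ε hε => ?_
    have hε2 : 0 < ε / 2 := half_pos hε
    obtain ⟨k, hkε⟩ := hRk R (ε / 2) hε2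
    -- `|x - g (Rk k)| ≤ ε/2` : limits along `u` of eventually close sequences
    have hi : |x - g (Rk k)| ≤ ε / 2 := le_of_tendsto ((hx.sub (hk k)).abs) (hu.eventually hkε)
    -- `|g R - g (Rk k)| ≤ ε/2` : a cluster value of an eventually `ε/2`-small path
    have hφ : MapClusterPt (g R - g (Rk k)) (𝓝[>] (0:ℝ))
        (fun δ => bondDomainCrossingProb R δ - bondDomainCrossingProb (Rk k) δ) :=
      hg.continuousAt_comp (f := fun h : ConformalRectangle → ℝ => h R - h (Rk k))
        ((continuous_apply R).sub (continuous_apply (Rk k))).continuousAt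
    have hii : g R - g (Rk k) ∈ Icc (-(ε / 2)) (ε / 2) :=
      isClosed_Icc.mem_of_mapClusterPt hφ (hkε.mono fun δ hδ => abs_le.1 hδ)
    rw [mem_Icc] at hii
    rw [abs_le] at hi
    rw [Real.dist_eq, abs_le]
    constructor <;> linarith [hi.1, hi.2, hii.1, hii.2]
  rwa [hxg] at hx

/-- The converse: a joint sequential limit is a cluster point of the crossing-function path.
[folklore] -/
theorem mapClusterPt_of_tendsto {g : ConformalRectangle → ℝ} {u : ℕ → ℝ}
    (hu : Tendsto u atTop (𝓝[>] (0:ℝ)))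
    (hg : ∀ R : ConformalRectangle, Tendsto (fun n => bondDomainCrossingProb R (u n)) atTop (𝓝 (g R))) :
    MapClusterPt g (𝓝[>] (0:ℝ)) (fun (δ : ℝ) (R : ConformalRectangle) => bondDomainCrossingProb R δ) :=
  MapClusterPt.of_comp hu (tendsto_pi_nhds.2 hg).mapClusterPt

/-- **The cluster set is the set of joint sequential limits.** [folklore] -/
theorem mapClusterPt_iff_exists_tendsto (g : ConformalRectangle → ℝ) :
    MapClusterPt g (𝓝[>] (0:ℝ)) (fun (δ : ℝ) (R : ConformalRectangle) => bondDomainCrossingProb R δ) ↔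
      ∃ u : ℕ → ℝ, Tendsto u atTop (𝓝[>] (0:ℝ)) ∧
        ∀ R : ConformalRectangle, Tendsto (fun n => bondDomainCrossingProb R (u n)) atTop (𝓝 (g R)) :=
  ⟨exists_tendsto_of_mapClusterPt, fun ⟨_, hu, hg⟩ => mapClusterPt_of_tendsto hu hg⟩

end JointLimit

/-! ### The structure theory, restated for cluster points -/

namespace ClusterPt

variable {g : ConformalRectangle → ℝ}

/-- Every cluster point of the crossing-function path is translation invariant. [folklore] -/
theorem map_addLeft
    (hg : MapClusterPt g (𝓝[>] (0:ℝ)) (fun (δ : ℝ) (R : ConformalRectangle) => bondDomainCrossingProb R δ))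
    (R : ConformalRectangle) (e : ℂ) : g (R.map (Homeomorph.addLeft e)) = g R := by
  obtain ⟨u, hu, hgu⟩ := JointLimit.exists_tendsto_of_mapClusterPt hg
  exact JointLimit.map_addLeft hu hgu R e

/-- Every cluster point is quarter-turn invariant. [folklore] -/
theorem map_mul_I
    (hg : MapClusterPt g (𝓝[>] (0:ℝ)) (fun (δ : ℝ) (R : ConformalRectangle) => bondDomainCrossingProb R δ))
    (T : ℂ ≃ₜ ℂ) (hT : ∀ z, T z = Complex.I * z) (R : ConformalRectangle) : g (R.map T) = g R := by
  obtain ⟨u, -, hgu⟩ := JointLimit.exists_tendsto_of_mapClusterPt hg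
  exact JointLimit.map_mul_I hgu T hT R

/-- Every cluster point is mirror invariant (complex conjugation). [folklore] -/
theorem map_conj
    (hg : MapClusterPt g (𝓝[>] (0:ℝ)) (fun (δ : ℝ) (R : ConformalRectangle) => bondDomainCrossingProb R δ))
    (T : ℂ ≃ₜ ℂ) (hT : ∀ z, T z = (starRingEnd ℂ) z) (R : ConformalRectangle) : g (R.map T) = g R := by
  obtain ⟨u, -, hgu⟩ := JointLimit.exists_tendsto_of_mapClusterPt hg
  exact JointLimit.map_conj hgu T hT R

/-- Conditional on DKKMO, every cluster point is rotation invariant. [cite: DKKMO2020Rotational, Cor. 1.3 (q = 1)] -/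
theorem map_rotateQuad (hdk : dkkmo_crossing_rotation_invariance)
    (hg : MapClusterPt g (𝓝[>] (0:ℝ)) (fun (δ : ℝ) (R : ConformalRectangle) => bondDomainCrossingProb R δ))
    (α : ℝ) (R : ConformalRectangle) : g (rotateQuad α R) = g R := by
  obtain ⟨u, hu, hgu⟩ := JointLimit.exists_tendsto_of_mapClusterPt hg
  exact JointLimit.map_rotateQuad hdk hu hgu α R

/-- Every cluster point is continuous in the Schramm–Smirnov topology. [folklore] -/
theorem abs_sub_map_le
    (hg : MapClusterPt g (𝓝[>] (0:ℝ)) (fun (δ : ℝ) (R : ConformalRectangle) => bondDomainCrossingProb R δ))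
    (R : ConformalRectangle) {ε : ℝ} (hε : 0 < ε) :
    ∃ η : ℝ, 0 < η ∧ ∀ T : ℂ ≃ₜ ℂ,
      (∀ z ∈ Metric.cthickening 1 (closure R.carrier), dist (T z) z ≤ η) → |g (R.map T) - g R| ≤ ε := by
  obtain ⟨u, hu, hgu⟩ := JointLimit.exists_tendsto_of_mapClusterPt hg
  exact JointLimit.abs_sub_map_le hu hgu R hε

/-- **The cluster set is dilation invariant**: with `g`, also `R ↦ g (c·R)` is a cluster point
(`c > 0`). [folklore] -/
theorem map_dilate_mem
    (hg : MapClusterPt g (𝓝[>] (0:ℝ)) (fun (δ : ℝ) (R : ConformalRectangle) => bondDomainCrossingProb R δ))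
    {c : ℝ} (hc : 0 < c) (T : ℂ ≃ₜ ℂ) (hT : ∀ z, T z = (c : ℂ) * z) :
    MapClusterPt (fun R => g (R.map T)) (𝓝[>] (0:ℝ))
      (fun (δ : ℝ) (R : ConformalRectangle) => bondDomainCrossingProb R δ) := by
  obtain ⟨u, hu, hgu⟩ := JointLimit.exists_tendsto_of_mapClusterPt hg
  exact JointLimit.mapClusterPt_of_tendsto (JointLimit.tendsto_div_const hu hc)
    (fun R => JointLimit.tendsto_dilate hgu hc T hT R)

end ClusterPt

/-- **Registered sub-goal `clusterPt_iff_jointLimit` (line `registered`, lead c3) — the cluster set of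
the crossing-function path is the set of joint sequential limits**: `g` is a cluster point, as
`δ → 0⁺`, of `δ ↦ (R ↦ bondDomainCrossingProb R δ)` in the product space iff along some mesh sequence
`u n → 0⁺` the crossing probabilities of every conformal rectangle converge to `g`. Bridges the frame
items of routes `CardyAnchoredRigidity` / `CardyLocalRigidity` (cluster points) and the stubs / structure
theory of this line (sequential limits). [folklore] -/
theorem clusterPt_iff_jointLimit : ∀ g : Literature.Probability.RandomPlanarGeometry.ConformalRectangle → ℝ, MapClusterPt g (nhdsWithin (0 : ℝ) (Set.Ioi 0)) (fun (δ : ℝ) (R : Literature.Probability.RandomPlanarGeometry.ConformalRectangle) => Literature.Probability.Percolation.bondDomainCrossingProb R δ) ↔ ∃ u : ℕ → ℝ, Filter.Tendsto u Filter.atTop (nhdsWithin (0 : ℝ) (Set.Ioi 0)) ∧ ∀ R : Literature.Probability.RandomPlanarGeometry.ConformalRectangle, Filter.Tendsto (fun n => Literature.Probability.Percolation.bondDomainCrossingProb R (u n)) Filter.atTop (nhds (g R)) :=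
  JointLimit.mapClusterPt_iff_exists_tendsto

end Summit.CriticalPhenomena.CardyFormulaZ2.Cruxes.SubseqCardy.Birth

end
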